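import Summits.BirchSwinnertonDyer.BirchSwinnertonDyer.Theorems.PrintX9MuPartOfPrintKSClosed
import Summits.BirchSwinnertonDyer.BirchSwinnertonDyer.Theses.PrintX9
import Summits.BirchSwinnertonDyer.BirchSwinnertonDyer.Theses.PrintX10b
import HarnessLib

/-!
# Line `leaves_byname` on the shared μ-crux `MuInequalityCoherentPair` (stmt-BirchSwinnertonDyer-22642) —
# RESHAPED CUT v4: TWO STUBS = THE TWO `closes`-BINDERS F-161 / F-411 BY NAME (x9-p1 LEAD g10, 2026-08-29)

The crux (routes PrintX9 r20301 / PrintX10b r30301; one text, `Iff.rfl` to the letter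
`HeegnerMuPartStabilized.MuPartStabilizedCoherentPair`, L∃) was registered by the μ-LEAD lineage `bsd-line-x9-p1` g3 with
skeleton v3 `spec_witnesses` (sha b3a874e3; stubs `stub_howardInputs` · `stub_controlGlue` · `stub_h161`). Since then the cell
landed the whole road BELOW the print leaves: `HeegnerMuPartOfPrintKSClosed.muPartStabilizedCoherentPair_of_thm161_thm411 :
thm161_dvrKolyvaginBound → thm411_exists_kolyvaginSystem_one_ne_zero → MuPartStabilizedCoherentPair` (p68xxxx chain: D1's Eisenstein
DVR setting + `SatisfiesH` (stub A `howardInputs_holds`), the KS-LINK, the m-uniform discrete/compact control (`controlGlueKS_holds`),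
the frame-restricted Kummer = strict theorem `kummerStrictOnFrames_holds` replacing the leaf G-2.4, the cyclic-port engine).
So v3's two worker stubs are DISCHARGED in the tree modulo the leaves, and the honest registry reads:
«22642 closes modulo EXACTLY the two cite-only print leaves F-161 (Howard 2004 Thm. 1.6.1) and F-411 (CGLS 2022 Thm. 4.1.1,
KS form) — both ALREADY binders `hH` / `hK` of `PrintX9.closes` and `PrintX10b.closes`», i.e. the crux adds NOTHING to either
route's trust base beyond `closes` itself. `stub_h161` keeps its v3 name and signature (every «stub_h161 = G87» reference of the
G87 ENGINE board and every `--supports 22642` landing stands); `stub_h411` is new (F-411 by name). Composition concludes the letter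
AND both route decls BY NAME; `sorry` only inside `stub_*`. No summit statement is proved; thm161 is NOT proved; BSD is NOT proved
by any of this.
-/

set_option linter.dupNamespace false
set_option autoImplicit false

namespace Summit.BirchSwinnertonDyer.BirchSwinnertonDyer.Cruxes.MuInequalityCoherentPair.LeavesByName

open Summit.BirchSwinnertonDyer.BirchSwinnertonDyer.Theorems

/-! ## The two stubs (the ONLY sorries of the file) — cite-only print leaves BY NAME -/

/-- Stub `stub_h161` — the CITE-ONLY print leaf Howard 2004 Thm. 1.6.1 (`Howard2004.thm161_dvrKolyvaginBound`, F-161 =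
route binder `hH : HowardDVRKolyvaginBound`); name and signature identical to skeleton v3. Closes only if the leaf becomes a
kernel theorem BY NAME (the G87 ENGINE road is a CONDITIONAL discharge under a discriminant guard, REF-167). Not worker-sized.
[cite: Howard2004HeegnerKolyvagin, Thm. 1.6.1 (arXiv:1202.6340 Thm. 2.6.1)] -/
theorem stub_h161 : Literature.NumberTheory.GaloisCohomology.Howard2004.thm161_dvrKolyvaginBound := by
  sorry

/-- Stub `stub_h411` — the CITE-ONLY print leaf CGLS 2022 Thm. 4.1.1 in Kolyvagin-system form with Rem. 4.1.4
(`CastellaGrossiLeeSkinner2022.thm411_exists_kolyvaginSystem_one_ne_zero`, F-411 = route binder `hK :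
CGLSHeegnerKolyvaginSystem`). Closes only if the leaf becomes a kernel theorem (Howard §1.7/§2.3 KS axioms for Heegner classes
+ Cornut–Vatsal non-vanishing; XL). Not worker-sized. [cite: CastellaGrossiLeeSkinner2022, Thm. 4.1.1, Rem. 4.1.4 (arXiv:2008.02571 §4.1)] -/
theorem stub_h411 :
    Literature.NumberTheory.EllipticCurves.CastellaGrossiLeeSkinner2022.thm411_exists_kolyvaginSystem_one_ne_zero := by
  sorry

/-! ## Composition (kernel-checked, no `sorry` outside the stubs) -/

/-- **The crux letter L∃ from the two stubs** — `HeegnerMuPartOfPrintKSClosed.muPartStabilizedCoherentPair_of_thm161_thm411`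
applied to the two leaves. -/
theorem MuPartStabilizedCoherentPair_of
    (h161 : Literature.NumberTheory.GaloisCohomology.Howard2004.thm161_dvrKolyvaginBound)
    (h411 : Literature.NumberTheory.EllipticCurves.CastellaGrossiLeeSkinner2022.thm411_exists_kolyvaginSystem_one_ne_zero) :
    HeegnerMuPartStabilized.MuPartStabilizedCoherentPair :=
  HeegnerMuPartOfPrintKSClosed.muPartStabilizedCoherentPair_of_thm161_thm411 h161 h411

/-- **ROW 9 — the crux decl BY NAME** `Theses.PrintX9.MuInequalityCoherentPair` (stmt-BirchSwinnertonDyer-22642) from the two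
stubs (the route text is the letter verbatim, `Iff.rfl`). -/
theorem MuInequalityCoherentPair_of
    (h161 : Literature.NumberTheory.GaloisCohomology.Howard2004.thm161_dvrKolyvaginBound)
    (h411 : Literature.NumberTheory.EllipticCurves.CastellaGrossiLeeSkinner2022.thm411_exists_kolyvaginSystem_one_ne_zero) :
    Summit.BirchSwinnertonDyer.BirchSwinnertonDyer.Theses.PrintX9.MuInequalityCoherentPair :=
  MuPartStabilizedCoherentPair_of h161 h411

/-- **ROW 10 twin — the same item over `Theses.PrintX10b`** (identical text). -/
theorem MuInequalityCoherentPair_of_X10b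
    (h161 : Literature.NumberTheory.GaloisCohomology.Howard2004.thm161_dvrKolyvaginBound)
    (h411 : Literature.NumberTheory.EllipticCurves.CastellaGrossiLeeSkinner2022.thm411_exists_kolyvaginSystem_one_ne_zero) :
    Summit.BirchSwinnertonDyer.BirchSwinnertonDyer.Theses.PrintX10b.MuInequalityCoherentPair :=
  MuPartStabilizedCoherentPair_of h161 h411

/-- The composed line from the stubs (sorries only through `stub_*`): the letter. -/
theorem MuPartStabilizedCoherentPair_of_stubs : HeegnerMuPartStabilized.MuPartStabilizedCoherentPair :=
  MuPartStabilizedCoherentPair_of stub_h161 stub_h411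

/-- The composed line from the stubs: row 9's decl BY NAME. -/
theorem MuInequalityCoherentPair_of_stubs :
    Summit.BirchSwinnertonDyer.BirchSwinnertonDyer.Theses.PrintX9.MuInequalityCoherentPair :=
  MuInequalityCoherentPair_of stub_h161 stub_h411

/-- The composed line from the stubs: row 10's decl BY NAME. -/
theorem MuInequalityCoherentPair_of_stubs_X10b :
    Summit.BirchSwinnertonDyer.BirchSwinnertonDyer.Theses.PrintX10b.MuInequalityCoherentPair :=
  MuInequalityCoherentPair_of_X10b stub_h161 stub_h411

end Summit.BirchSwinnertonDyer.BirchSwinnertonDyer.Cruxes.MuInequalityCoherentPair.LeavesByName
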